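import Summits.NavierStokesRegularity.NavierStokesRegularity.Theses.RellichScar
import Summits.NavierStokesRegularity.NavierStokesRegularity.Theorems.ScarRigidity.Negative.LogicAndLoadBearing
import Literature.Analysis.FluidPDE.TypeIAncientMild
import Literature.Analysis.FluidPDE.ParasiticSlabFlow
import Mathlib.MeasureTheory.Measure.Haar.NormedSpace
import Summits.NavierStokesRegularity.NavierStokesRegularity.Theorems.RellichScarScarRigidityCoulombBounds
import HarnessLib

/-!
# `ScarRigidity` — line `finite-energy-log-convexity`, stub `stub_coulombEnergyPackage`:
# the Coulomb energy of the twin difference vanishes at the final time (crux stmt-NavierStokesRegularity-11717)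

Helper file 7 of S4-E (`stub_coulombEnergyPackage`). With the twin majorant
`‖w(t,x)‖ ≤ K(-t)/(‖x‖ + √(-t))³` of S2 the Coulomb pairing of a slice obeys
**`|∫ ⟪w(t), Γ ⋆ w(t)⟫| ≤ C₀ K² (-t)^{3/2}`** (`abs_integral_inner_newtonPotential_le`), hence tends to
`0` as `t ↑ 0` (`tendsto_integral_inner_newtonPotential`): the potential of the slice is
`≲ K(-t) (-t)^{-1/8} ‖x‖^{-3/4}` (decay file), and `∫ ρ⁻³ ‖x‖^{-3/4} dx = (-t)^{-3/8} ∫ (‖y‖+1)⁻³‖y‖^{-3/4} dy`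
by the dilation `x = √(-t) y` (`integral_inv_norm_add_cube_mul_rpow_eq`). This is the scaling
statement `‖w(t)‖_{Ḣ⁻¹} ≲ (-t)^{3/4}` of the line's blueprint; no measurability of `w` is needed.
-/

noncomputable section

open Set Filter Function MeasureTheory Metric TopologicalSpace
open scoped Topology ENNReal NNReal InnerProductSpace RealInnerProductSpace
open Literature.Analysis.FluidPDE
open Summit.NavierStokesRegularity.NavierStokesRegularity.Theses.RellichScar
open Summit.NavierStokesRegularity.NavierStokesRegularity.Theorems.ScarRigidity.Negative

set_option linter.dupNamespace false

namespace Summit.NavierStokesRegularity.NavierStokesRegularity.Theorems.RellichScarScarRigidity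

open Real

/-! ## Dilation of the radial weight -/

/-- **Scaling**: `∫ (‖x‖+a)⁻³ ‖x‖^{-s} dx = a^{-s} ∫ (‖y‖+1)⁻³ ‖y‖^{-s} dy` on `ℝ³` for `a > 0`
(substitute `x = a y`, Mathlib `Measure.integral_comp_inv_smul_of_nonneg`). [folklore] -/
theorem integral_inv_norm_add_cube_mul_rpow_eq {a : ℝ} (ha : 0 < a) (s : ℝ) :
    ∫ x : EuclideanSpace ℝ (Fin 3), ((‖x‖ + a) ^ 3)⁻¹ * ‖x‖ ^ (-s) =
      a ^ (-s) * ∫ y : EuclideanSpace ℝ (Fin 3), ((‖y‖ + 1) ^ 3)⁻¹ * ‖y‖ ^ (-s) := by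
  set f : (EuclideanSpace ℝ (Fin 3)) → ℝ := fun y => ((‖y‖ + 1) ^ 3)⁻¹ * ‖y‖ ^ (-s) with hf
  have key := Measure.integral_comp_inv_smul_of_nonneg (volume : Measure (EuclideanSpace ℝ (Fin 3)))
    f ha.le
  rw [finrank_euclideanSpace, Fintype.card_fin, smul_eq_mul] at key
  have e : ∀ x : EuclideanSpace ℝ (Fin 3), f (a⁻¹ • x) =
      a ^ (3 : ℕ) * a ^ s * (((‖x‖ + a) ^ 3)⁻¹ * ‖x‖ ^ (-s)) := by
    intro x
    simp only [hf, norm_smul, norm_inv, Real.norm_of_nonneg ha.le]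
    have h1 : ((a⁻¹ * ‖x‖ + 1) ^ 3)⁻¹ = a ^ (3 : ℕ) * ((‖x‖ + a) ^ 3)⁻¹ := by
      rw [show a⁻¹ * ‖x‖ + 1 = a⁻¹ * (‖x‖ + a) by field_simp, mul_pow, mul_inv, inv_pow, inv_inv]
    have h2 : (a⁻¹ * ‖x‖) ^ (-s) = a ^ s * ‖x‖ ^ (-s) := by
      rw [Real.mul_rpow (inv_nonneg.2 ha.le) (norm_nonneg _), Real.inv_rpow ha.le, Real.rpow_neg ha.le,
        inv_inv]
    rw [h1, h2]; ring
  simp_rw [e] at key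
  rw [integral_const_mul, mul_assoc] at key
  have has : 0 < a ^ s := Real.rpow_pos_of_pos ha s
  have h3 : (0 : ℝ) < a ^ (3 : ℕ) := pow_pos ha 3
  have k2 := mul_left_cancel₀ h3.ne' key
  rw [Real.rpow_neg ha.le, ← k2, ← mul_assoc, inv_mul_cancel₀ has.ne', one_mul]

/-! ## The Coulomb pairing of a slice is `O((-t)^{3/2})` -/

/-- **`|∫ ⟪w(t), Γ ⋆ w(t)⟫| ≤ C₀ K² (-t)^{3/2}`** for every field with the twin majorant
`‖w(t,x)‖ ≤ K(-t)/(‖x‖+√(-t))³` (`C₀` absolute): the `Ḣ⁻¹` smallness of the twin difference at the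
final time (decay of the potential, then the dilation `x = √(-t) y`). [folklore] -/
theorem exists_abs_integral_inner_newtonPotential_le :
    ∃ C₀ : ℝ, 0 ≤ C₀ ∧
      ∀ (w : ℝ → (EuclideanSpace ℝ (Fin 3)) → (EuclideanSpace ℝ (Fin 3))) (K : ℝ),
        (∀ t < 0, ∀ x : EuclideanSpace ℝ (Fin 3), ‖w t x‖ ≤ K * (-t) / (‖x‖ + Real.sqrt (-t)) ^ 3) →
        ∀ t < 0, |∫ x, ⟪w t x, ∫ y, newtonKernel (x - y) • w t y⟫| ≤
          C₀ * K ^ 2 * (-t) ^ (3 / 2 : ℝ) := by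
  obtain ⟨Kc, hKc, hdec⟩ := exists_integral_norm_newtonKernel_smul_le
  set J : ℝ := ∫ y : EuclideanSpace ℝ (Fin 3), ((‖y‖ + 1) ^ 3)⁻¹ * ‖y‖ ^ (-(3 / 4 : ℝ)) with hJ
  have hJ0 : 0 ≤ J := integral_nonneg fun y => by positivity
  refine ⟨Kc * J, by positivity, fun w K hw t ht => ?_⟩
  set a : ℝ := Real.sqrt (-t) with ha_def
  have ha : 0 < a := Real.sqrt_pos.2 (by linarith)
  set A : ℝ := |K| * (-t) with hA_def
  have hA : 0 ≤ A := mul_nonneg (abs_nonneg _) (by linarith)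
  -- the majorant in product form
  have hwA : ∀ x : EuclideanSpace ℝ (Fin 3), ‖w t x‖ ≤ A * ((‖x‖ + a) ^ 3)⁻¹ := by
    intro x
    have hρ : 0 < (‖x‖ + a) ^ 3 := by positivity
    calc ‖w t x‖ ≤ K * (-t) / (‖x‖ + a) ^ 3 := hw t ht x
      _ ≤ A / (‖x‖ + a) ^ 3 := by
          apply div_le_div_of_nonneg_right _ hρ.le
          exact mul_le_mul_of_nonneg_right (le_abs_self K) (by linarith)
      _ = A * ((‖x‖ + a) ^ 3)⁻¹ := div_eq_mul_inv _ _
  -- pointwise bound of the integrand off the origin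
  have hpt : ∀ᵐ x ∂(volume : Measure (EuclideanSpace ℝ (Fin 3))),
      ‖⟪w t x, ∫ y, newtonKernel (x - y) • w t y⟫‖ ≤
        Kc * A ^ 2 * a ^ (-(1 / 4 : ℝ)) * (((‖x‖ + a) ^ 3)⁻¹ * ‖x‖ ^ (-(3 / 4 : ℝ))) := by
    filter_upwards [ae_ne_point 0] with x hx
    have hψ : ‖∫ y, newtonKernel (x - y) • w t y‖ ≤ Kc * A * a ^ (-(1 / 4 : ℝ)) * ‖x‖ ^ (-(3 / 4 : ℝ)) :=
      (norm_integral_le_integral_norm _).trans (hdec a A ha hA (w t) hwA x hx)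
    calc ‖⟪w t x, ∫ y, newtonKernel (x - y) • w t y⟫‖
        ≤ ‖w t x‖ * ‖∫ y, newtonKernel (x - y) • w t y‖ := norm_inner_le_norm _ _
      _ ≤ A * ((‖x‖ + a) ^ 3)⁻¹ * (Kc * A * a ^ (-(1 / 4 : ℝ)) * ‖x‖ ^ (-(3 / 4 : ℝ))) :=
          mul_le_mul (hwA x) hψ (norm_nonneg _) (by positivity)
      _ = Kc * A ^ 2 * a ^ (-(1 / 4 : ℝ)) * (((‖x‖ + a) ^ 3)⁻¹ * ‖x‖ ^ (-(3 / 4 : ℝ))) := by ring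
  have hmaj := (integrable_inv_norm_add_cube_mul_rpow ha (by norm_num : (0 : ℝ) < 3 / 4)
    (by norm_num)).const_mul (Kc * A ^ 2 * a ^ (-(1 / 4 : ℝ)))
  -- the exponent bookkeeping: `A² a^{-1/4} a^{-3/4} = K² (-t)^{3/2}`
  have hexp : A ^ 2 * a ^ (-(1 / 4 : ℝ)) * a ^ (-(3 / 4 : ℝ)) = K ^ 2 * (-t) ^ (3 / 2 : ℝ) := by
    have hnt : 0 < -t := by linarith
    have h1 : a ^ (-(1 / 4 : ℝ)) * a ^ (-(3 / 4 : ℝ)) = a ^ (-(1 : ℝ)) := by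
      rw [← Real.rpow_add ha]; norm_num
    have h2 : a ^ (-(1 : ℝ)) = (-t) ^ (-(1 / 2 : ℝ)) := by
      rw [ha_def, Real.sqrt_eq_rpow, ← Real.rpow_mul hnt.le]; norm_num
    have h3 : (-t) ^ (3 / 2 : ℝ) = (-t) ^ (2 : ℕ) * (-t) ^ (-(1 / 2 : ℝ)) := by
      rw [← Real.rpow_natCast, ← Real.rpow_add hnt]; norm_num
    have h4 : A ^ 2 = K ^ 2 * (-t) ^ (2 : ℕ) := by rw [hA_def, mul_pow, sq_abs]
    calc A ^ 2 * a ^ (-(1 / 4 : ℝ)) * a ^ (-(3 / 4 : ℝ))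
        = A ^ 2 * (a ^ (-(1 / 4 : ℝ)) * a ^ (-(3 / 4 : ℝ))) := by ring
      _ = K ^ 2 * (-t) ^ (2 : ℕ) * (-t) ^ (-(1 / 2 : ℝ)) := by rw [h1, h2, h4]
      _ = K ^ 2 * (-t) ^ (3 / 2 : ℝ) := by rw [h3]; ring
  calc |∫ x, ⟪w t x, ∫ y, newtonKernel (x - y) • w t y⟫|
      = ‖∫ x, ⟪w t x, ∫ y, newtonKernel (x - y) • w t y⟫‖ := (Real.norm_eq_abs _).symm
    _ ≤ ∫ x, ‖⟪w t x, ∫ y, newtonKernel (x - y) • w t y⟫‖ := norm_integral_le_integral_norm _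
    _ ≤ ∫ x, Kc * A ^ 2 * a ^ (-(1 / 4 : ℝ)) * (((‖x‖ + a) ^ 3)⁻¹ * ‖x‖ ^ (-(3 / 4 : ℝ))) :=
        integral_mono_of_nonneg (Eventually.of_forall fun x => norm_nonneg _) hmaj hpt
    _ = Kc * A ^ 2 * a ^ (-(1 / 4 : ℝ)) * (a ^ (-(3 / 4 : ℝ)) * J) := by
        rw [integral_const_mul, integral_inv_norm_add_cube_mul_rpow_eq ha]
    _ = Kc * J * (A ^ 2 * a ^ (-(1 / 4 : ℝ)) * a ^ (-(3 / 4 : ℝ))) := by ring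
    _ = Kc * J * K ^ 2 * (-t) ^ (3 / 2 : ℝ) := by rw [hexp]; ring

/-- **The Coulomb pairing of the twin difference tends to `0` as `t ↑ 0`.** [folklore] -/
theorem tendsto_integral_inner_newtonPotential
    {w : ℝ → (EuclideanSpace ℝ (Fin 3)) → (EuclideanSpace ℝ (Fin 3))} {K : ℝ}
    (hw : ∀ t < 0, ∀ x : EuclideanSpace ℝ (Fin 3), ‖w t x‖ ≤ K * (-t) / (‖x‖ + Real.sqrt (-t)) ^ 3) :
    Tendsto (fun t => ∫ x, ⟪w t x, ∫ y, newtonKernel (x - y) • w t y⟫) (𝓝[<] 0) (𝓝 0) := by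
  obtain ⟨C₀, hC₀, hle⟩ := exists_abs_integral_inner_newtonPotential_le
  have hbound : ∀ᶠ t in 𝓝[<] (0 : ℝ),
      ‖∫ x, ⟪w t x, ∫ y, newtonKernel (x - y) • w t y⟫‖ ≤ C₀ * K ^ 2 * (-t) ^ (3 / 2 : ℝ) := by
    filter_upwards [self_mem_nhdsWithin] with t ht
    rw [Real.norm_eq_abs]
    exact hle w K hw t ht
  have hcont : Continuous fun t : ℝ => C₀ * K ^ 2 * (-t) ^ (3 / 2 : ℝ) :=
    continuous_const.mul (continuous_neg.rpow_const fun _ => Or.inr (by norm_num))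
  have hlim : Tendsto (fun t : ℝ => C₀ * K ^ 2 * (-t) ^ (3 / 2 : ℝ)) (𝓝[<] 0) (𝓝 0) := by
    have h := hcont.tendsto (0 : ℝ)
    rw [neg_zero, Real.zero_rpow (by norm_num), mul_zero] at h
    exact h.mono_left nhdsWithin_le_nhds
  exact squeeze_zero_norm' hbound hlim

/-! ## Registered sub-goal (helper stub of `stub_coulombEnergyPackage`) -/

/-- **Registered helper stub `stub_coulombEnergyVanishing`** (crux stmt-NavierStokesRegularity-11717,
line `finite-energy-log-convexity`, helper of S4-E): the Coulomb pairing of a field with the twin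
majorant tends to `0` at the final time, as registered. [folklore] -/
theorem stub_coulombEnergyVanishing :
    ∀ (w : ℝ → EuclideanSpace ℝ (Fin 3) → EuclideanSpace ℝ (Fin 3)) (K : ℝ),
      (∀ t < 0, ∀ x : EuclideanSpace ℝ (Fin 3), ‖w t x‖ ≤ K * (-t) / (‖x‖ + Real.sqrt (-t)) ^ 3) →
      Filter.Tendsto (fun t => ∫ x, ⟪w t x, ∫ y, newtonKernel (x - y) • w t y⟫)
        (nhdsWithin 0 (Set.Iio 0)) (nhds 0) :=
  fun _w _K hw => tendsto_integral_inner_newtonPotential hw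

end Summit.NavierStokesRegularity.NavierStokesRegularity.Theorems.RellichScarScarRigidity

end
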